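import Literature.NumberTheory.EllipticCurves.BDPAnticyclotomicPAdicLFunction
import HarnessLib

/-!
# Bertolini–Darmon–Prasanna 2013, Thm. 4.6 / (5.1.11) / Thm. 5.5 / (5.2.3)–(5.2.4): the constants
# `C(f,χ,c)`, `w(f,χ)`, the algebraic part `L_alg(f,χ⁻¹,0)` and the `p`-adic value `L_p(f,χ)`,
# VERBATIM at weight `k = 2` and conductor `c = 1`, read on `φ = χ·𝐍_K⁻¹`

Trunk T-NT-EC (`Literature/NumberTheory/EllipticCurves`), story `BertoliniDarmonPrasanna2013/`
(M. Bertolini, H. Darmon, K. Prasanna, *Generalized Heegner cycles and `p`-adic Rankin `L`-series*,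
Duke Math. J. 162 (2013) 1033–1148; bib key `BertoliniDarmonPrasanna2013`; author version held as
`paper:url-39cfb2a03b1d`, whose displays — empty in the store text layer — were re-assembled at the
glyph level by bsd-eis-lit g17, HOME/lit/src/bdp13-author/, LIT-DOSSIER §40 (A)–(F); author = journal
numbering). FIVE definitions with a body and small proved API; NO named fact (D-0014/D-0026 accounting:
+0). The tree's existing BDP vocabulary is CASTELLA's normalisation of the same `p`-adic `L`-function
(`bdpInterpolationValue` = Castella CJM 6 (2018) Thm. 3.1's display, `IsBDPLFunction`,
`BDPAnticyclotomicPAdicLFunction.lean`); this file types BDP's OWN display, which Castella, JIMJ 17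
(2018) §2 [cas-split] re-uses by reference at a `p`-new form ("`w(f,χ)` and `C(f,χ,c)` are the
constants defined in [bdp1] and [loc.cit., Thm. 4.6]"). Cell `bsd-eis`, seat `bsd-eis-k5-c4` (RULING
L11: BDP13's display typed in its own currency with the auxiliary data explicit); consumers: the fact
`Castella2018Exceptional.thm210_thm211_bdpDisplay_pNew` and the kernel rescaling
`Summits/BirchSwinnertonDyer/Rank1Residual/X2/NonsplitBDPValueDisplayPNew.lean` (BDP display ↦ Castella
display with virtual periods, BDP Rem. 5.6 / 5.8).

## The printed statements (author version; LIT-DOSSIER §40 (A)–(F), verbatim)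

(p. 34) "a Hecke character of `K` of infinity type `(ℓ₁, ℓ₂)` is a continuous homomorphism
`χ : 𝔸_K^× → ℂ^×` satisfying `χ(α·x·z_∞) = χ(x)·z_∞^{−ℓ₁} z̄_∞^{−ℓ₂}`", "(4.1.5) … As a function on
ideals, `χ` satisfies `χ((α)) = α^{ℓ₁} ᾱ^{ℓ₂}` for all principal ideals `(α)` with `α ≡ 1 mod 𝔣_χ`",
"`L(f,χ,s) = L(π_f × π_χ, s − (k−1+ℓ₁+ℓ₂)/2)`", "Set `ℓ := |ℓ₁ − ℓ₂|`". (p. 37) "`S(f) := {q : q ∣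
(N, d_K), q ∤ N_{ε_f}}`". **Theorem 4.6** (p. 38): "Let `f` be a normalised eigenform in `S_k(Γ₀(N),
ε_f)` and let `χ ∈ Σ^{(2)}_cc(𝔑)` be a Hecke character of `K` of infinity type `(k+j, −j)`. Suppose also
that `c` and `d_K` are odd, and let `w_K` denote the number of roots of unity in `K`. Then `C(f,χ,c)·
L(f,χ⁻¹,0) = |∑_{[𝔞] ∈ Pic(𝒪_c)} χ⁻¹(𝔞)N𝔞^{−j}·(δ_k^j f)(𝔞⁻¹, t_𝔞)|²`, where … the constant `C(f,χ,c)`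
is given by **`C(f,χ,c) = (1/4)·π^{k+2j−1} Γ(j+1)Γ(k+j) w_K |d_K|^{1/2}·c·vol(𝒪_c)^{−ℓ}·2^{#S_f}·
∏_{q∣c}(q − ε_K(q))/(q − 1)`**", with `ℓ = k+2j` and `vol(𝒪_c) = c·√|d_K|/2` the covolume of `𝒪_c ⊂
ℂ` (p. 56, after (4.7.1): "`|Λ_τ|²ℑ(τ) = vol(𝒪_c)`", `𝒪_c = Λ_τ(ℤτ + ℤ)`, p. 40). (p. 57) "Given a
Hecke character `χ ∈ Σ^{(2)}_cc(𝔑)` of infinity type `(k+j, −j)`, it will be convenient to set **`χ_j :=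
χN^j`** for the associated Hecke character of infinity type `(k+2j, 0)`." (p. 58) "**(5.1.6)** `(𝔟, Nc)
= 1`, `𝔟𝔑 = (b_N)`"; Lemma 5.2: "`f^ρ(w_N(E,t,ω)) = w_f f(E,t,ω)`", `|w_f| = 1`, (4.1.4) `w_N(f) =
w_f f^ρ`; "After these preliminaries, we define a complex scalar of norm one by the rule: **(5.1.11)
`w(f,χ) := w_f·ε_f(N𝔟)⁻¹ χ_j(𝔟) (−N)^{k/2+j} b_N^{−k−2j}`**"; Lemma 5.3: "(1) It depends only on `f`
and `χ` and not on the choice of pair `(𝔟, b_N)` satisfying (5.1.6); (2) It belongs to the finite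
extension `L` of `K` generated by `K_f`, `K_χ`, and `√−N`". **Theorem 5.5** (p. 60): "For all
`χ ∈ Σ^{(2)}_cc(𝔑)` of infinity type `(k+j, −j)`, the quantity **`L_alg(f,χ⁻¹,0) := w(f,χ)⁻¹ C(f,χ,c)·
L(f,χ⁻¹,0)/Ω^{2(k+2j)}`** belongs to `F`" (NO inverse on `C` — glyph positions checked by lit g17),
with (5.1.15) `ω₀ = Ω·2πi dw` (the complex period of `(A₀, ω₀)`). §5.2 (p. 61): "fix a prime `𝔭` of
`K` above `p` … an embedding `ι_p : F → ℂ_p`. The special values `L_alg(f,χ⁻¹,0)` can be viewed, through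
the embedding `ι_p`, as `p`-adic numbers"; "(5.2.2) `ω₀ = Ω_p·ω_can`"; "For all `χ ∈ Σ^{(2)}_cc(𝔑)` of
infinity type `(k+j, −j)`, we set **(5.2.3) `L_p(f,χ) := Ω_p^{2(k+2j)}(1 − χ⁻¹(𝔭̄)a_p +
χ⁻²(𝔭̄)ε_f(p)p^{k−1})² L_alg(f,χ⁻¹,0)` (5.2.4) `= Ω_p^{2(k+2j)}(1 − α_pχ⁻¹(𝔭̄))²(1 − β_pχ⁻¹(𝔭̄))²
L_alg(f,χ⁻¹,0)`**, where `α_p, β_p` denote the parameters of `f` at `p`" (p. 34: "`α_qβ_q =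
q^{k−1}ε_f(q)` if `q` does not divide `N`, and `α_qβ_q = 0` otherwise"). Rem. 5.6 ("a change in `ω_A`
affects both sides of (5.1.16) in the same way"), Rem. 5.8 ("Replacing `ι` by a `ℤ_p^×`-multiple `aι`
has the effect of multiplying `L_p(f,χ)` by `a^{2(k+2j)}`").

## The specialisation typed here (LIT-DOSSIER §40 (E), certified at the page in §40 (H)/(H′))

`k = 2`, `c = 1`, `ε_f = 𝟙` (`f` on `Γ₀(N)`), `χ` of infinity type `(2+j, −j)`, `j ≥ 0`. DICTIONARY TO
THE TREE (reading (R1) of the cell's record, certified by bsd-eis-lit g17): such a `χ` is `φ·𝐍_K` with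
`𝐍_K` the norm character (infinity type `(1,1)`, `𝐍_K(𝔞) = N𝔞` on ideals) and `φ := χ𝐍_K⁻¹` of
infinity type `(1+j, −1−j) = (n, −n)`, **`n = j+1 ≥ 1`**, `ℓ = 2n`, `2(k+2j) = 4n`, `k/2+j = n`,
`k+2j = 2n`; `χ` unramified iff `φ` is; `χ_j(𝔟) = χ(𝔟)N𝔟^j = φ(𝔟)·N𝔟^{1+j} = φ(𝔟)·N𝔟^n`;
`ε_f(N𝔟) = 1`; `χ⁻¹(𝔭̄) = χ(𝔭)p^{−k} = φ(𝔭)·N𝔭·p⁻² = φ(𝔭)p⁻¹` (`χ(𝔭)χ(𝔭̄) = χ((p)) = p^k`, the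
identity printed in the proof of [cas-split] Thm. 2.11: "`χ(𝔭)p^{−1−j} = χ⁻¹(𝔭̄)p^{r+1−j}`"), hence
BDP's Euler factor `(1 − χ⁻¹(𝔭̄)a_p + χ⁻²(𝔭̄)ε_f(p)p)` reads `1 − a_p p⁻¹φ(𝔭) + ε_p φ(𝔭)²` with
`ε_p = p⁻¹` at `p ∤ N` and — by (5.2.4) with `β_p = 0` — `ε_p = 0` at `p ∣ N`, EXACTLY the tree's
reading in `bdpInterpolationValue` (Castella CJM Thm. 3.1: "`1 − a_p p⁻¹φ(𝔭) + ε_pφ(𝔭)²`"), in the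
orientation of the infinity type fixed by the A-registry facts (module docstring of
`BDPAnticyclotomicPAdicLFunction.lean`); (R1a) `L(f,χ⁻¹,0) = L(f,φ⁻¹𝐍_K⁻¹,0) = L(f,φ⁻¹,1) =
L(f/K,φ,1)` is the CENTRAL value `rankinSelbergValueHecke f φ 1` with NO residual constant (LIT-DOSSIER
§40 (H′): BDP p. 34 against the tree's Euler product, factor by factor). With `vol(𝒪_K) = |d_K|^{1/2}/2`:
  `C(f,χ,1) = (1/4)·π^{2n−1}·Γ(n)Γ(n+1)·w_K·|d_K|^{1/2}·(|d_K|^{1/2}/2)^{−2n}·2^{#S(f)}`   (`bdpConstC`),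
  `w(f,χ) = w_f·(φ(𝔟)·N𝔟^n)·(−N)^n·b_N^{−2n}`                                       (`bdpConstW`),
  `L_alg(f,χ⁻¹,0) = w(f,χ)⁻¹·C(f,χ,1)·L(f/K,φ,1)/Ω^{4n}`                             (`bdpLalg`),
  `L_p(f,χ) = Ω_p^{4n}·ι⁻¹((1 − a_p p⁻¹φ(𝔭) + ε_pφ(𝔭)²)²·L_alg(f,χ⁻¹,0))`             (`bdpLp`),
the algebraic number `L_alg` being read in `ℂ_p` through `ι⁻¹ : ℂ → ℚ̄_p ⊂ ℂ_p` for the tree's embedding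
datum `ι : ℚ̄_p ≃ ℂ` (BDP's `ι_p`). Here `N` is the level of `f` (for [cas-split]: `N₀p` with `N₀`
prime to `p`; the `N` of (5.1.6)/(5.1.11) is then cas-split's prime-to-`p` level `N₀`, a PARAMETER
of `bdpConstW`), `w_K = #μ(K)` (`NumberField.Units.torsionOrder K`), `d_K = NumberField.discr K`,
`#S(f)` a parameter, `φ(𝔟)` the ideal value `heckeIdealValueExtZero φ 𝔟` (multiplicative extension of
the values at uniformizers, BDP (4.1.5) / Nekovář 1995 §3.4, extended by zero at ramified places),
`b_N ∈ ℂ` (an element of `𝓞 K` read along an embedding), `w_f ∈ ℂ` (Lemma 5.2), `Ω ∈ ℂ`, `Ω_p ∈ ℂ_p`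
PARAMETERS. Typer lint: no `instance`, no `notation`; definitions only, nothing asserted.

## References

* [BertoliniDarmonPrasanna2013] Duke Math. J. 162 (2013) 1033–1148: p. 34, (4.1.4)–(4.1.5), p. 37
  (S(f)), Thm. 4.6 (p. 38), p. 56 ((4.7.1), vol 𝒪_c), §5.1 (χ_j p. 57, (5.1.6), Lemma 5.2, (5.1.11),
  Lemma 5.3, Thm. 5.5, (5.1.15), Rem. 5.6), §5.2 ((5.2.2)–(5.2.4), Rem. 5.8).
* [Castella2018Exceptional] F. Castella, JIMJ 17 (2018), §2.5, Thm. 2.10–2.11 (arXiv:1507.04260 pp. 13–14).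
* [Castella2018] F. Castella, Camb. J. Math. 6 (2018), Thm. 3.1 (arXiv:1704.06608 p. 9) (the tree's display).
* [Nekovar1995] J. Nekovář, Math. Ann. 302 (1995), §3.4 (characters on ideals prime to the conductor).
-/

noncomputable section

open scoped Classical MatrixGroups ModularForm
open CongruenceSubgroup NumberField IsDedekindDomain Field
open Literature.NumberTheory.EllipticCurves.ModularForms
open Literature.NumberTheory.GaloisRepresentations

namespace Literature.NumberTheory.EllipticCurves.BertoliniDarmonPrasanna2013

universe u

/-! ### §1 Definitions with a body -/

section Defs

variable {K : Type u} [Field K] [NumberField K]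

/-- **`χ(𝔞)` as a function on ideals, extended by zero** (BDP 2013 (4.1.5) "As a function on
ideals, `χ` satisfies …"; Nekovář 1995 §3.4): for an integral ideal `𝔞 = ∏_v v^{e_v}` of `𝓞 K`, the
product `∏_v φ(ϖ_v)^{e_v}` of the values at uniformizers (`heckeValueExtZero`, which is `0` at a
place where `φ` ramifies), a finite product over the primes dividing `𝔞` (`e_v` = the multiplicity
`count` of `v` in the factorisation of `𝔞`; the zero ideal has no factorisation and gets the empty
product). For `φ` unramified at every `v ∣ 𝔞` this is the classical ideal-theoretic value `φ(𝔞)`.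
[cite: BertoliniDarmonPrasanna2013, (4.1.5) (p. 34)] [cite: Nekovar1995, §3.4] -/
def heckeIdealValueExtZero (φ : HeckeCharacter K) (𝔞 : Ideal (𝓞 K)) : ℂ :=
  ∏ᶠ v : HeightOneSpectrum (𝓞 K),
    heckeValueExtZero φ v ^ ((Associates.mk v.asIdeal).count (Associates.mk 𝔞).factors)

/-- **BDP 2013, Thm. 4.6: the constant `C(f,χ,c)` at `k = 2`, `c = 1`**, for `χ` of infinity type
`(2+j, −j) = (n+1, 1−n)`, `n = j+1`: `C(f,χ,1) = (1/4)·π^{k+2j−1}·Γ(j+1)Γ(k+j)·w_K·|d_K|^{1/2}·c·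
vol(𝒪_c)^{−ℓ}·2^{#S_f}·∏_{q∣c}(…)` with `ℓ = k+2j = 2n`, `vol(𝒪_K) = |d_K|^{1/2}/2`, the product over
`q ∣ c` empty, i.e. `(1/4)·π^{2n−1}·Γ(n)·Γ(n+1)·w_K·|d_K|^{1/2}·(|d_K|^{1/2}/2)^{−2n}·2^{#S(f)}`;
here `w_K = #μ(K)` (`NumberField.Units.torsionOrder K`), `d_K = NumberField.discr K`, and `#S(f)`,
`S(f) = {q : q ∣ (N, d_K)}` (`ε_f = 𝟙`), is the parameter `sf` (the level `N` is not a datum of `K`).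
[cite: BertoliniDarmonPrasanna2013, Thm. 4.6 (p. 38) with p. 34 (ℓ) and p. 56 (vol 𝒪_c)] -/
def bdpConstC (K : Type u) [Field K] [NumberField K] (sf n : ℕ) : ℂ :=
  (1 / 4 : ℂ) * (Real.pi : ℂ) ^ (2 * n - 1) * Complex.Gamma n * Complex.Gamma (n + 1) *
    (Units.torsionOrder K : ℂ) * (Real.sqrt |(NumberField.discr K : ℝ)| : ℂ) *
    ((Real.sqrt |(NumberField.discr K : ℝ)| : ℂ) / 2) ^ (-(2 * n : ℤ)) * (2 : ℂ) ^ sf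

/-- **BDP 2013, (5.1.11): the norm-one scalar `w(f,χ)` at `k = 2`, `ε_f = 𝟙`**, for `χ = φ·𝐍_K` of
infinity type `(2+j, −j)`, `n = j+1`, and an auxiliary pair `(𝔟, b_N)` with `(𝔟, N) = 1`, `𝔟𝔑 = (b_N)`
((5.1.6)): `w(f,χ) = w_f·ε_f(N𝔟)⁻¹·χ_j(𝔟)·(−N)^{k/2+j}·b_N^{−k−2j}` with `χ_j = χN^j`, so `χ_j(𝔟) =
φ(𝔟)·N𝔟^{1+j} = φ(𝔟)·N𝔟^n`, `ε_f(N𝔟) = 1`, `k/2+j = n`, `k+2j = 2n`: `w(f,χ) = w_f·(φ(𝔟)·N𝔟^n)·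
(−N)^n·b_N^{−2n}`. Parameters: Lemma 5.2's scalar `w_f` ((4.1.4) `w_N(f) = w_f f^ρ`), the level `N` of
(5.1.6) (for [cas-split]: the prime-to-`p` level), the pair `(𝔟, b_N)` (`b_N ∈ 𝓞 K` read in `ℂ` along
an embedding). [cite: BertoliniDarmonPrasanna2013, (5.1.11) (p. 58) with p. 57 (χ_j) and (5.1.6)] -/
def bdpConstW (wf : ℂ) (φ : HeckeCharacter K) (𝔟 : Ideal (𝓞 K)) (N : ℕ) (bN : ℂ) (n : ℕ) : ℂ :=
  wf * (heckeIdealValueExtZero φ 𝔟 * ((Ideal.absNorm 𝔟 : ℕ) : ℂ) ^ n) * (-(N : ℂ)) ^ n *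
    bN ^ (-(2 * n : ℤ))

/-- **BDP 2013, Thm. 5.5: `L_alg(f,χ⁻¹,0) := w(f,χ)⁻¹·C(f,χ,c)·L(f,χ⁻¹,0)/Ω^{2(k+2j)}`** at `k = 2`,
`c = 1`, `χ = φ·𝐍_K`, `n = j+1`: `w(f,χ)⁻¹·C(f,χ,1)·L(f/K,φ,1)/Ω^{4n}`, where `L(f,χ⁻¹,0) =
L(f,φ⁻¹,1)` is the central Rankin–Selberg value (p. 34: the twist by `𝐍_K^{−1}` shifts `s` by `1`), in
the tree `rankinSelbergValueHecke f φ 1` (LIT-DOSSIER §40 (H′): no residual constant), and `Ω ∈ ℂ` is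
the complex period of (5.1.15) (a parameter). Parameters `sf`, `wf`, `(𝔟, b_N)`, `N₀` as in
`bdpConstC` / `bdpConstW`. [cite: BertoliniDarmonPrasanna2013, Thm. 5.5 (p. 60) with p. 34] -/
def bdpLalg {N : ℕ} (f : CuspForm (Gamma0 N) 2) (sf : ℕ) (wf : ℂ) (𝔟 : Ideal (𝓞 K)) (N₀ : ℕ)
    (bN : ℂ) (Ω : ℂ) (φ : HeckeCharacter K) (n : ℕ) : ℂ :=
  (bdpConstW wf φ 𝔟 N₀ bN n)⁻¹ * bdpConstC K sf n * rankinSelbergValueHecke f φ 1 / Ω ^ (4 * n)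

/-- **BDP 2013, (5.2.3)–(5.2.4): `L_p(f,χ) := Ω_p^{2(k+2j)}·(1 − χ⁻¹(𝔭̄)a_p + χ⁻²(𝔭̄)ε_f(p)p^{k−1})²·
L_alg(f,χ⁻¹,0) = Ω_p^{2(k+2j)}(1 − α_pχ⁻¹(𝔭̄))²(1 − β_pχ⁻¹(𝔭̄))² L_alg(f,χ⁻¹,0)`**, the algebraic
number `L_alg` read in `ℂ_p` through the embedding (BDP's `ι_p : F → ℂ_p`; here `ι⁻¹ : ℂ → ℚ̄_p ⊂ ℂ_p`
for `ι : ℚ̄_p ≃ ℂ`), at `k = 2`, `c = 1`, `χ = φ·𝐍_K`, `n = j+1`: `Ω_p^{4n}·ι⁻¹((1 − a_p p⁻¹φ(𝔭) +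
ε_pφ(𝔭)²)²·L_alg)` with `ε_p = p⁻¹` if `p ∤ N` (`α_pβ_p = p`, p. 34) and `ε_p = 0` if `p ∣ N` (`α_pβ_p =
0`; [cas-split] Thm. 2.10: "`β_p = 0` here, since `f` has level divisible by `p`") — the Euler factor of
the tree's `bdpInterpolationValue` (`χ⁻¹(𝔭̄) = φ(𝔭)p⁻¹`, module docstring), `a_p = cuspCoeff f p`,
`φ(𝔭) = heckeValueExtZero φ 𝔭`, `Ω_p ∈ ℂ_p` the period of (5.2.2) (a parameter).
[cite: BertoliniDarmonPrasanna2013, (5.2.3)–(5.2.4) (p. 61) with p. 34 (α_q β_q)]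
[cite: Castella2018Exceptional, Thm. 2.10 (arXiv:1507.04260 p. 13)] -/
def bdpLp (p : ℕ) [Fact p.Prime] (ι : PadicAlgCl p ≃+* ℂ) {N : ℕ} (f : CuspForm (Gamma0 N) 2)
    (𝔭 : HeightOneSpectrum (𝓞 K)) (sf : ℕ) (wf : ℂ) (𝔟 : Ideal (𝓞 K)) (N₀ : ℕ) (bN : ℂ) (Ω : ℂ)
    (Ωp : ℂ_[p]) (φ : HeckeCharacter K) (n : ℕ) : ℂ_[p] :=
  let εp : ℂ := if p ∣ N then 0 else ((p : ℂ))⁻¹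
  let φ𝔭 : ℂ := heckeValueExtZero φ 𝔭
  Ωp ^ (4 * n) *
    ((ι.symm ((1 - cuspCoeff f p * ((p : ℂ))⁻¹ * φ𝔭 + εp * φ𝔭 ^ 2) ^ 2 *
      bdpLalg f sf wf 𝔟 N₀ bN Ω φ n) : PadicAlgCl p) : ℂ_[p])

end Defs

/-! ### §2 API (proved) -/

section API

variable {K : Type u} [Field K] [NumberField K]

/-- At the unit ideal the ideal value is `1` (empty product): `χ((1)) = 1` (BDP (4.1.5) with `α = 1`).
[cite: BertoliniDarmonPrasanna2013, (4.1.5) (p. 34)] -/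
theorem heckeIdealValueExtZero_top (φ : HeckeCharacter K) :
    heckeIdealValueExtZero φ ⊤ = 1 := by
  unfold heckeIdealValueExtZero
  refine finprod_eq_one_of_forall_eq_one fun v ↦ ?_
  have h0 : (Associates.mk v.asIdeal).count (Associates.mk (⊤ : Ideal (𝓞 K))).factors = 0 := by
    rw [← Ideal.one_eq_top, Associates.mk_one, Associates.factors_one]
    exact Associates.count_zero (Associates.irreducible_mk.mpr v.irreducible)
  rw [h0, pow_zero]

/-- At a prime `v` the ideal value is the value at a uniformizer of `v` (extended by zero): the
multiplicity of `v` in `v` is `1` and that of any other prime is `0` (the ideal-theoretic character of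
BDP (4.1.5) / Nekovář §3.4 "`𝒲(λ)` for `λ` prime to the conductor" at a prime ideal).
[cite: BertoliniDarmonPrasanna2013, (4.1.5) (p. 34)] [cite: Nekovar1995, §3.4] -/
theorem heckeIdealValueExtZero_prime (φ : HeckeCharacter K) (v : HeightOneSpectrum (𝓞 K)) :
    heckeIdealValueExtZero φ v.asIdeal = heckeValueExtZero φ v := by
  unfold heckeIdealValueExtZero
  rw [finprod_eq_single _ v]
  · rw [Associates.count_self (Associates.irreducible_mk.mpr v.irreducible), pow_one]
  · intro w hw
    have hne : Associates.mk w.asIdeal ≠ Associates.mk v.asIdeal := by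
      intro h
      apply hw
      rw [Associates.mk_eq_mk_iff_associated, associated_iff_eq] at h
      exact HeightOneSpectrum.ext h
    rw [Associates.factors_self (Associates.irreducible_mk.mpr v.irreducible),
      Associates.count_some (Associates.irreducible_mk.mpr w.irreducible),
      Multiset.count_singleton, if_neg (fun h ↦ hne (Subtype.ext_iff.mp h)), pow_zero]

/-- The multiplicity of `v` in a nonzero ideal vanishes off the (finite) set of its prime factors, so
the ideal value `χ(𝔞) = ∏_{v ∣ 𝔞} χ(ϖ_v)^{e_v}` is a FINITE product over any finset containing them
(BDP (4.1.5): a character of the group of fractional ideals prime to `𝔣`).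
[cite: BertoliniDarmonPrasanna2013, (4.1.5) (p. 34)] -/
theorem heckeIdealValueExtZero_eq_prod (φ : HeckeCharacter K) {𝔞 : Ideal (𝓞 K)} (h𝔞 : 𝔞 ≠ ⊥)
    (T : Finset (HeightOneSpectrum (𝓞 K))) (hT : ∀ v : HeightOneSpectrum (𝓞 K), v.asIdeal ∣ 𝔞 → v ∈ T) :
    heckeIdealValueExtZero φ 𝔞 =
      ∏ v ∈ T, heckeValueExtZero φ v ^ ((Associates.mk v.asIdeal).count (Associates.mk 𝔞).factors) := by
  unfold heckeIdealValueExtZero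
  refine finprod_eq_prod_of_mulSupport_subset _ fun v hv ↦ ?_
  refine hT v ?_
  by_contra hdvd
  apply hv
  have h0 : (Associates.mk v.asIdeal).count (Associates.mk 𝔞).factors = 0 := by
    by_contra hne
    have h𝔞0 : 𝔞 ≠ 0 := fun h ↦ h𝔞 (h.trans Ideal.zero_eq_bot)
    exact hdvd ((Associates.count_ne_zero_iff_dvd h𝔞0 v.irreducible).mp hne)
  show heckeValueExtZero φ v ^ _ = 1
  rw [h0, pow_zero]

/-- At `p ∣ N` the Euler factor of `bdpLp` has `ε_p = 0` (BDP (5.2.4) with `β_p = 0`; [cas-split]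
Thm. 2.10): `L_p(f,χ) = Ω_p^{4n}·ι⁻¹((1 − a_p p⁻¹φ(𝔭))²·L_alg)`.
[cite: Castella2018Exceptional, Thm. 2.10 (arXiv:1507.04260 p. 13)] -/
theorem bdpLp_of_dvd {p : ℕ} [Fact p.Prime] (ι : PadicAlgCl p ≃+* ℂ) {N : ℕ} (hpN : p ∣ N)
    (f : CuspForm (Gamma0 N) 2) (𝔭 : HeightOneSpectrum (𝓞 K)) (sf : ℕ) (wf : ℂ) (𝔟 : Ideal (𝓞 K))
    (N₀ : ℕ) (bN Ω : ℂ) (Ωp : ℂ_[p]) (φ : HeckeCharacter K) (n : ℕ) :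
    bdpLp p ι f 𝔭 sf wf 𝔟 N₀ bN Ω Ωp φ n =
      Ωp ^ (4 * n) *
        ((ι.symm ((1 - cuspCoeff f p * ((p : ℂ))⁻¹ * heckeValueExtZero φ 𝔭) ^ 2 *
          bdpLalg f sf wf 𝔟 N₀ bN Ω φ n) : PadicAlgCl p) : ℂ_[p]) := by
  simp [bdpLp, hpN]

end API

end Literature.NumberTheory.EllipticCurves.BertoliniDarmonPrasanna2013

end
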